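import Summits.HubbardSuperconductivity.HubbardSuperconductivity.Theorems.AnisotropyChordDoobJohnsonChordLogSlopeNearAF

/-!
# Route `AnisotropyChord`, crux `ChordXY` (stmt-HubbardSuperconductivity-8146), line `doob-johnson-chord`:
# the registered HARDEST stub `stub_frozenFieldChord` HOLDS NEAR THE ANTIFERROMAGNETIC END `Δ = -1`
# (lead-8146-chordxy g1)

Vocabulary of `…Theorems.AnisotropyChordDoobJohnsonChordDefs`.  The frozen-field chord
`(1+Δ) · E_{|ψ₀|²}[g_ψ] ≤ Λ(ψ)` (`ψ₀` any normalised XY sector ground state, `ψ ≥ 0` the real normalised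
sector ground state at `Δ`, `g_ψ = field M ψ` the Doob–Johnson local field) reads `0 ≤ Λ` at `Δ = -1` and
is STRICT there (`Λ > 0`, `lam_pos_of_isGS`).  Along the `C^∞` Perron family `Ψ`
(`exists_smooth_perronFamily`) both sides are CONTINUOUS in `Δ` (`continuous_frozenAverage`: the field
`g_{Ψ Δ}(σ) = (Oᵣ Ψ Δ)(σ)/Ψ Δ σ` is continuous — positive denominator on the sector, constantly `0` off it),
so the chord holds, strictly, on a neighbourhood `[-1, -1+ε_M]`; real non-negative normalised sector
ground states are unique (`eq_of_isGS_nonneg`: equal squares and signs), and the XY law `|ψ₀|²` is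
`(Ψ 0)²`, which transports the statement to the stub's binders:

* `stub_frozenFieldChord_near_AF` — **for every even `M ≥ 4` there is `ε > 0` such that the registered
  stub's inequality holds for all `Δ ∈ [-1, -1+ε]`** and all `ψ₀, ψ` as in the stub.

With `…LogSlopeNearAF`: BOTH research stubs of the line hold near `Δ = -1`; the open content of each is
a window `[-1+ε_M, 0]` resp. `[-1+ε_M, 0)`, with the binding end at the XY point (instrument records
K1/K2: h/slack → 0.995 at Δ = -0.05, penalty/slack max at Δ* ≈ -0.55).  Folklore + bookkeeping; no
definition; sorry-free.  HONEST: `ε` is `M`-dependent and non-explicit; nothing here proves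
`stub_frozenFieldChord`, `stub_logSlopeBound` or `ChordXY`; superconductivity in the Hubbard model is
not advanced.
-/

set_option linter.dupNamespace false

noncomputable section

namespace Summit.HubbardSuperconductivity.HubbardSuperconductivity.Theorems.AnisotropyChord.DoobJohnsonChord

open Matrix Finset Filter Topology
open scoped ContDiff
open Literature.MathematicalPhysics.QuantumLattice Literature.Probability.LatticeModels

variable (M : ℕ) [NeZero M]

/-! ### Uniqueness of the real non-negative normalised sector ground state -/

/-- Two real non-negative normalised sector ground states at the same anisotropy are EQUAL as functions
(they differ by a unit phase, and equal squares with equal signs are equal). [folklore] -/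
theorem eq_of_isGS_nonneg (hM : Even M) (u : ℝ) {ψ φ : Config M → ℝ}
    (hψ : IsGS M u (ofReal M ψ)) (hψnn : ∀ σ, 0 ≤ ψ σ)
    (hφ : IsGS M u (ofReal M φ)) (hφnn : ∀ σ, 0 ≤ φ σ) : ψ = φ := by
  obtain ⟨ψr, -, -, -, huniq⟩ := sectorPerron_condensate M hM u
  obtain ⟨a, ha, hψa⟩ := huniq _ hψ
  obtain ⟨b, hb, hφb⟩ := huniq _ hφ
  funext σ
  have h1 : ψ σ ^ 2 = ψr σ ^ 2 := by
    rw [← norm_sq_ofReal M ψ σ, hψa]; exact norm_sq_eq_of_phase M a ha ψr σ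
  have h2 : φ σ ^ 2 = ψr σ ^ 2 := by
    rw [← norm_sq_ofReal M φ σ, hφb]; exact norm_sq_eq_of_phase M b hb ψr σ
  exact (sq_eq_sq₀ (hψnn σ) (hφnn σ)).1 (h1.trans h2.symm)

/-! ### Continuity of the frozen average along the smooth family -/

/-- Along a continuous family of real amplitudes, positive on the half-filled configurations and zero off
them, each local field `Δ ↦ field M (Ψ Δ) σ` is continuous. [folklore] -/
theorem continuous_field_family {Ψ : ℝ → Config M → ℝ} (hΨ : Continuous Ψ)
    (hpos : ∀ u σ, (∑ z, (σ z : ℕ)) = M ^ 2 / 2 → 0 < Ψ u σ)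
    (hoff : ∀ u σ, (∑ z, (σ z : ℕ)) ≠ M ^ 2 / 2 → Ψ u σ = 0) (σ : Config M) :
    Continuous fun u => field M (Ψ u) σ := by
  have hcoord : ∀ τ, Continuous fun u => Ψ u τ := fun τ => (continuous_apply τ).comp hΨ
  have hnum : Continuous fun u =>
      ((Matrix.of fun σ τ : Config M => (Otot M σ τ).re) *ᵥ Ψ u) σ := by
    have h : (fun u => ((Matrix.of fun σ τ : Config M => (Otot M σ τ).re) *ᵥ Ψ u) σ) =
        fun u => ∑ τ, (Otot M σ τ).re * Ψ u τ := by
      funext u; simp [mulVec, dotProduct]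
    rw [h]
    exact continuous_finsetSum _ fun τ _ => continuous_const.mul (hcoord τ)
  have hf : (fun u => field M (Ψ u) σ) =
      fun u => ((Matrix.of fun σ τ : Config M => (Otot M σ τ).re) *ᵥ Ψ u) σ / Ψ u σ := by
    funext u; rw [field_eq, re_otot_mulVec_ofReal]
  rw [hf]
  by_cases hσ : (∑ z, (σ z : ℕ)) = M ^ 2 / 2
  · exact hnum.div (hcoord σ) fun u => (hpos u σ hσ).ne'
  · have h0 : (fun u => ((Matrix.of fun σ τ : Config M => (Otot M σ τ).re) *ᵥ Ψ u) σ / Ψ u σ) =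
        fun _ => (0:ℝ) := by
      funext u; rw [hoff u σ hσ, div_zero]
    rw [h0]
    exact continuous_const

/-- The frozen average `Δ ↦ (1+Δ)·Σ_σ (Ψ 0 σ)² g_{Ψ Δ}(σ) - Λ(Ψ Δ)` is continuous along such a family.
[folklore] -/
theorem continuous_frozenAverage {Ψ : ℝ → Config M → ℝ} (hΨ : ContDiff ℝ ∞ Ψ)
    (hpos : ∀ u σ, (∑ z, (σ z : ℕ)) = M ^ 2 / 2 → 0 < Ψ u σ)
    (hoff : ∀ u σ, (∑ z, (σ z : ℕ)) ≠ M ^ 2 / 2 → Ψ u σ = 0) :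
    Continuous fun Δ : ℝ =>
      (1 + Δ) * (∑ σ, Ψ 0 σ ^ 2 * field M (Ψ Δ) σ) - lam M (ofReal M (Ψ Δ)) := by
  have hc : Continuous Ψ := hΨ.continuous
  refine ((continuous_const.add continuous_id).mul
    (continuous_finsetSum _ fun σ _ => continuous_const.mul
      (continuous_field_family M hc hpos hoff σ))).sub ?_
  exact (contDiff_lam_family M hΨ).continuous

/-! ### The frozen-field chord near `Δ = -1` -/

/-- **The registered hardest stub `stub_frozenFieldChord` holds near the antiferromagnetic end.**  For
every even `M ≥ 4` there is `ε > 0` such that for all `Δ ∈ [-1, -1+ε]`, every normalised XY sector ground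
state `ψ₀` and the real non-negative normalised sector ground state `ψ` at `Δ`:
`(1+Δ) · Σ_σ ‖ψ₀ σ‖² g_ψ(σ) ≤ Λ(ψ)` (continuity along the smooth Perron family from the STRICT
inequality `0 < Λ` at `Δ = -1`; uniqueness of real non-negative ground states; the XY law is `(Ψ 0)²`).
[bookkeeping] -/
theorem stub_frozenFieldChord_near_AF :
    ∀ (M : ℕ) [NeZero M], Even M → 4 ≤ M → ∃ ε : ℝ, 0 < ε ∧ ∀ Δ ∈ Set.Icc (-1:ℝ) (-1 + ε),
      ∀ (ψ₀ : Config M → ℂ) (ψ : Config M → ℝ),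
        IsGS M 0 ψ₀ → IsGS M Δ (ofReal M ψ) → (∀ σ, 0 ≤ ψ σ) →
          (1 + Δ) * (∑ σ, ‖ψ₀ σ‖ ^ 2 * field M ψ σ) ≤ lam M (ofReal M ψ) := by
  intro M _ hM _
  obtain ⟨Ψ, hΨs, hGS, hnn, hpos, hoff, -⟩ := exists_smooth_perronFamily M hM
  -- the continuous defect `F Δ = (1+Δ) E_{Ψ0²}[g_{ΨΔ}] - Λ(ΨΔ)`, negative at `Δ = -1`
  have hF := continuous_frozenAverage M hΨs hpos hoff
  have h0 : (1 + (-1:ℝ)) * (∑ σ, Ψ 0 σ ^ 2 * field M (Ψ (-1)) σ) - lam M (ofReal M (Ψ (-1))) < 0 := by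
    have := lam_pos_of_isGS M hM (-1) _ (hGS (-1))
    linarith
  have hev : ∀ᶠ Δ in 𝓝 (-1:ℝ),
      (1 + Δ) * (∑ σ, Ψ 0 σ ^ 2 * field M (Ψ Δ) σ) - lam M (ofReal M (Ψ Δ)) < 0 :=
    hF.continuousAt.eventually (Iio_mem_nhds h0)
  obtain ⟨ε, hε, hball⟩ := Metric.eventually_nhds_iff.1 hev
  refine ⟨ε / 2, by linarith, fun Δ hΔ ψ₀ ψ hGS₀ hGSψ hψnn => ?_⟩
  have hdist : dist Δ (-1) < ε := by
    rw [Real.dist_eq, abs_lt]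
    constructor <;> linarith [hΔ.1, hΔ.2]
  have hneg := hball hdist
  -- identify `ψ` with `Ψ Δ` and the XY law with `(Ψ 0)²`
  have hψ : ψ = Ψ Δ := eq_of_isGS_nonneg M hM Δ hGSψ hψnn (hGS Δ) (hnn Δ)
  obtain ⟨ψr0, hnn0, hGSr0, -, huniq0⟩ := sectorPerron_condensate M hM 0
  have hr0 : ψr0 = Ψ 0 := eq_of_isGS_nonneg M hM 0 hGSr0 hnn0 (hGS 0) (hnn 0)
  obtain ⟨a, ha, hψa⟩ := huniq0 ψ₀ hGS₀
  have hlaw : ∀ σ, ‖ψ₀ σ‖ ^ 2 = Ψ 0 σ ^ 2 := fun σ => by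
    rw [hψa, norm_sq_eq_of_phase M a ha ψr0 σ, hr0]
  simp only [hlaw]
  rw [hψ]
  linarith

end Summit.HubbardSuperconductivity.HubbardSuperconductivity.Theorems.AnisotropyChord.DoobJohnsonChord

end
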